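import Literature.NumberTheory.Weil1964.ArchFollandCoordinates
import Literature.RingTheory.Norm.MatrixAlgebra
import Mathlib.RingTheory.Norm.Transitivity
import HarnessLib

/-!
# The `𝕐`-block of a Siegel element in Folland coordinates and its determinant `N_{(F ⊗ ℝ)/ℝ}(det M_∞)`

Topic `NumberTheory/Weil1964`; namespace `Literature.NumberTheory.Weil1964`.  KERNEL MATHEMATICS ONLY: one explicit
definition with body (`freqFrame`) and proved theorems; no `def … : Prop` record, no axiom, no proof hole.

If `q ∈ Sp(W_𝔸)` acts on the Lagrangian `𝕐 = 0 × 𝔸^ι` through an adelic matrix, `q(0, Y) = (0, M Y)`, then its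
archimedean action in the Folland coordinates `Ξ = archFolland T e` of a frame `e` (`ArchFollandCoordinates.archPhaseMap`)
is `(0, y) ↦ (0, φ (M_∞ φ⁻¹ y))` with the frequency frame `φ = follandFreq e ∘ T_∞` (`freqFrame`;
`archPhaseMap_zero_of_apply_zero`), so the `𝕐`-block `d` of the Siegel decomposition of the phase map is a real conjugate
of `M_∞ = archMat M` acting on `(F ⊗ ℝ)^ι`, and **`det d = N_{(F ⊗ ℝ)/ℝ}(det M_∞)`** (`det_eq_norm_of_archPhaseMap_zero`:
`LinearMap.det_conj`, `LinearMap.det_restrictScalars`), whose absolute value is the archimedean module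
`∏_w ‖·‖_w^{[F_w:ℝ]}` (`Literature.RingTheory.Norm.MatrixAlgebra.abs_algebraNorm_mixedSpace`): **`|det d| = |det M_∞|_∞`**
(`abs_det_eq_norm_of_archPhaseMap_zero`).  This is the archimedean modulus `|det|` entering the Siegel-parabolic
normalisation `χ(det) |det|^{1/2}` of the Weil representation ([Weil1964, Chap. III n° 46 (42)]; [Kudla1994, §3 (3.5)];
[Folland1989, §4.2 (4.24)]).

## References

* [Weil1964] A. Weil, Acta Math. 111 (1964), Chap. III n° 46, (42) p. 202.
* [Kudla1994] S. Kudla, Israel J. Math. 87 (1994), §3 (3.5).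
* [Folland1989] G. B. Folland, *Harmonic Analysis in Phase Space*, Princeton UP 1989, §4.2 (4.24).
-/

set_option autoImplicit false

noncomputable section

open scoped Matrix Classical
open NumberField NumberField.mixedEmbedding NumberField.InfinitePlace IsDedekindDomain

namespace Literature.NumberTheory.Weil1964

open Literature.RepresentationTheory.HeisenbergGroup Literature.NumberTheory.Automorphic

/-! ## §1 The `𝕐`-block in Folland coordinates -/

section Block

variable {F : Type} [Field F] [NumberField F] {ι : Type} [Fintype ι] [DecidableEq ι] {σ : Type*} [Fintype σ]
  (T : Matrix ι ι (AdeleRing (𝓞 F) F)) (e : (ι → mixedSpace F) ≃L[ℝ] (σ → ℝ)) (hT : IsUnit (archMat F ι T))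

omit [Fintype ι] [DecidableEq ι] in
/-- `archVec 0 = 0`. [cite: Weil1964, Chap. III n° 38 p. 189] -/
private theorem archVec_zero_aux : archVec F ι (0 : ι → mixedSpace F) = 0 := by
  rw [archVec, Prod.mk_zero_zero]; exact map_zero _

omit [Fintype ι] [DecidableEq ι] in
/-- `piArch 0 = 0`. [cite: Weil1964, Chap. III n° 38 p. 189] -/
private theorem piArch_zero_aux : piArch F ι (0 : ι → AdeleRing (𝓞 F) F) = 0 := by
  rw [← archVec_zero_aux (F := F) (ι := ι), piArch_archVec]

/-- **the frequency frame `φ = follandFreq e ∘ T_∞ : (F ⊗ ℝ)^ι ≃ ℝ^σ`** (the second Folland coordinate).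
[cite: Folland1989, §4.2 (4.24); Weil1964, Chap. III n° 46 (42)] -/
def freqFrame : (ι → mixedSpace F) ≃ₗ[ℝ] (σ → ℝ) :=
  (LinearEquiv.ofBijective ((Matrix.toLin' (archMat F ι T)).restrictScalars ℝ) (mulVec_bijective_of_isUnit hT)).trans
    (follandFreqEquiv F ι e)

/-- unfolding. [cite: Folland1989, §4.2 (4.24)] -/
theorem freqFrame_apply (w : ι → mixedSpace F) : freqFrame T e hT w = follandFreq F ι e (archMat F ι T *ᵥ w) := rfl

/-- `Ξ (0, w) = (0, φ w)`. [cite: Folland1989, §4.2 (4.24)] -/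
theorem archFolland_zero (w : ι → mixedSpace F) : archFolland T e (0, w) = (0, freqFrame T e hT w) := by
  rw [archFolland_apply, map_zero]; rfl

/-- `Ξ⁻¹ (0, y) = (0, φ⁻¹ y)`. [cite: Folland1989, §4.2 (4.24)] -/
theorem archFollandInv_zero (y : σ → ℝ) : archFollandInv T e hT (0, y) = (0, (freqFrame T e hT).symm y) := by
  apply (archFolland_bijective T e hT).1
  rw [archFolland_archFollandInv, archFolland_zero T e hT, LinearEquiv.apply_symm_apply]

/-- if `q(0, Y) = (0, M Y)` then `archAct q (0, w) = (0, M_∞ w)`. [cite: Weil1964, Chap. III n° 46 (42) p. 202] -/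
theorem archAct_zero_of_apply_zero (q : symplecticGroup (polar (adelicForm F ι T))) (M : Matrix ι ι (AdeleRing (𝓞 F) F))
    (hq : ∀ Y : ι → AdeleRing (𝓞 F) F,
      (q.1 : ((ι → AdeleRing (𝓞 F) F) × (ι → AdeleRing (𝓞 F) F)) ≃ₗ[AdeleRing (𝓞 F) F]
        ((ι → AdeleRing (𝓞 F) F) × (ι → AdeleRing (𝓞 F) F))) (0, Y) = (0, M *ᵥ Y))
    (w : ι → mixedSpace F) : archAct T q (0, w) = (0, archMat F ι M *ᵥ w) := by
  have h1 : (q.1 : ((ι → AdeleRing (𝓞 F) F) × (ι → AdeleRing (𝓞 F) F)) ≃ₗ[AdeleRing (𝓞 F) F]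
      ((ι → AdeleRing (𝓞 F) F) × (ι → AdeleRing (𝓞 F) F))) (archVec F ι 0, archVec F ι w) =
        (0, archVec F ι (archMat F ι M *ᵥ w)) := by
    rw [archVec_zero_aux, hq, mulVec_archVec]
  unfold archAct
  rw [h1, piArch_archVec, piArch_zero_aux]

/-- **the `𝕐`-block in Folland coordinates**: `archPhaseMap q (0, y) = (0, φ (M_∞ (φ⁻¹ y)))`.
[cite: Weil1964, Chap. III n° 46 (42) p. 202; Folland1989, §4.2 (4.24)] -/
theorem archPhaseMap_zero_of_apply_zero (q : symplecticGroup (polar (adelicForm F ι T)))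
    (M : Matrix ι ι (AdeleRing (𝓞 F) F))
    (hq : ∀ Y : ι → AdeleRing (𝓞 F) F,
      (q.1 : ((ι → AdeleRing (𝓞 F) F) × (ι → AdeleRing (𝓞 F) F)) ≃ₗ[AdeleRing (𝓞 F) F]
        ((ι → AdeleRing (𝓞 F) F) × (ι → AdeleRing (𝓞 F) F))) (0, Y) = (0, M *ᵥ Y))
    (y : σ → ℝ) :
    archPhaseMap T e hT q (0, y) = (0, freqFrame T e hT (archMat F ι M *ᵥ (freqFrame T e hT).symm y)) := by
  unfold archPhaseMap
  rw [archFollandInv_zero, archAct_zero_of_apply_zero T q M hq, archFolland_zero T e hT]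

/-- **the determinant of the `𝕐`-block is `det_ℝ (M_∞ ↷ (F ⊗ ℝ)^ι)`**. [cite: Folland1989, §4.2 (4.24)] -/
theorem det_eq_of_archPhaseMap_zero (q : symplecticGroup (polar (adelicForm F ι T)))
    (M : Matrix ι ι (AdeleRing (𝓞 F) F))
    (hq : ∀ Y : ι → AdeleRing (𝓞 F) F,
      (q.1 : ((ι → AdeleRing (𝓞 F) F) × (ι → AdeleRing (𝓞 F) F)) ≃ₗ[AdeleRing (𝓞 F) F]
        ((ι → AdeleRing (𝓞 F) F) × (ι → AdeleRing (𝓞 F) F))) (0, Y) = (0, M *ᵥ Y))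
    (d : (σ → ℝ) ≃ₗ[ℝ] (σ → ℝ)) (hd : ∀ y, d y = (archPhaseMap T e hT q (0, y)).2) :
    LinearMap.det (d : (σ → ℝ) →ₗ[ℝ] (σ → ℝ)) =
      LinearMap.det ((Matrix.toLin' (archMat F ι M)).restrictScalars ℝ) := by
  have h : (d : (σ → ℝ) →ₗ[ℝ] (σ → ℝ)) =
      (freqFrame T e hT : (ι → mixedSpace F) →ₗ[ℝ] (σ → ℝ)) ∘ₗ ((Matrix.toLin' (archMat F ι M)).restrictScalars ℝ) ∘ₗ
        ((freqFrame T e hT).symm : (σ → ℝ) →ₗ[ℝ] (ι → mixedSpace F)) := by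
    apply LinearMap.ext
    intro y
    rw [LinearEquiv.coe_coe, hd y, archPhaseMap_zero_of_apply_zero T e hT q M hq]
    rfl
  rw [h, LinearMap.det_conj]

/-- **`det_ℝ (N ↷ (F ⊗ ℝ)^ι) = N_{(F ⊗ ℝ)/ℝ}(det N)`**. [cite: Weil1964, Chap. III n° 46 (42) p. 202] -/
theorem det_restrictScalars_toLin' (N : Matrix ι ι (mixedSpace F)) :
    LinearMap.det ((Matrix.toLin' N).restrictScalars ℝ) = Algebra.norm ℝ N.det := by
  rw [LinearMap.det_restrictScalars, LinearMap.det_toLin']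

/-- **`det d = N_{(F ⊗ ℝ)/ℝ}(det M_∞)`** for the `𝕐`-block `d` of `q` with `q(0, Y) = (0, M Y)`.
[cite: Weil1964, Chap. III n° 46 (42) p. 202; Folland1989, §4.2 (4.24); Kudla1994, §3 (3.5)] -/
theorem det_eq_norm_of_archPhaseMap_zero (q : symplecticGroup (polar (adelicForm F ι T)))
    (M : Matrix ι ι (AdeleRing (𝓞 F) F))
    (hq : ∀ Y : ι → AdeleRing (𝓞 F) F,
      (q.1 : ((ι → AdeleRing (𝓞 F) F) × (ι → AdeleRing (𝓞 F) F)) ≃ₗ[AdeleRing (𝓞 F) F]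
        ((ι → AdeleRing (𝓞 F) F) × (ι → AdeleRing (𝓞 F) F))) (0, Y) = (0, M *ᵥ Y))
    (d : (σ → ℝ) ≃ₗ[ℝ] (σ → ℝ)) (hd : ∀ y, d y = (archPhaseMap T e hT q (0, y)).2) :
    LinearMap.det (d : (σ → ℝ) →ₗ[ℝ] (σ → ℝ)) = Algebra.norm ℝ (archMat F ι M).det := by
  rw [det_eq_of_archPhaseMap_zero T e hT q M hq d hd, det_restrictScalars_toLin']

/-- **`|det d| = |det M_∞|_∞ = ∏_w ‖(det M)_w‖^{[F_w:ℝ]}`**. [cite: Weil1964, Chap. III n° 46 (42) p. 202; Kudla1994, §3 (3.5)] -/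
theorem abs_det_eq_norm_of_archPhaseMap_zero (q : symplecticGroup (polar (adelicForm F ι T)))
    (M : Matrix ι ι (AdeleRing (𝓞 F) F))
    (hq : ∀ Y : ι → AdeleRing (𝓞 F) F,
      (q.1 : ((ι → AdeleRing (𝓞 F) F) × (ι → AdeleRing (𝓞 F) F)) ≃ₗ[AdeleRing (𝓞 F) F]
        ((ι → AdeleRing (𝓞 F) F) × (ι → AdeleRing (𝓞 F) F))) (0, Y) = (0, M *ᵥ Y))
    (d : (σ → ℝ) ≃ₗ[ℝ] (σ → ℝ)) (hd : ∀ y, d y = (archPhaseMap T e hT q (0, y)).2) :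
    |LinearMap.det (d : (σ → ℝ) →ₗ[ℝ] (σ → ℝ))| = mixedEmbedding.norm (archMat F ι M).det := by
  rw [det_eq_norm_of_archPhaseMap_zero T e hT q M hq d hd, Literature.RingTheory.Norm.abs_algebraNorm_mixedSpace]

/-- the matrix of the `𝕐`-block exists as soon as `q` preserves `𝕐`: `M = ` the matrix of `Y ↦ (q(0, Y)).2`.
[cite: Weil1964, Chap. III n° 46 (42) p. 202] -/
theorem exists_apply_zero_eq_mulVec (q : symplecticGroup (polar (adelicForm F ι T)))
    (hq : ∀ Y : ι → AdeleRing (𝓞 F) F,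
      ((q.1 : ((ι → AdeleRing (𝓞 F) F) × (ι → AdeleRing (𝓞 F) F)) ≃ₗ[AdeleRing (𝓞 F) F]
        ((ι → AdeleRing (𝓞 F) F) × (ι → AdeleRing (𝓞 F) F))) (0, Y)).1 = 0) :
    ∃ M : Matrix ι ι (AdeleRing (𝓞 F) F), (∀ Y : ι → AdeleRing (𝓞 F) F,
      (q.1 : ((ι → AdeleRing (𝓞 F) F) × (ι → AdeleRing (𝓞 F) F)) ≃ₗ[AdeleRing (𝓞 F) F]
        ((ι → AdeleRing (𝓞 F) F) × (ι → AdeleRing (𝓞 F) F))) (0, Y) = (0, M *ᵥ Y)) ∧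
      M = LinearMap.toMatrix' ((LinearMap.snd _ _ _) ∘ₗ
        (q.1 : ((ι → AdeleRing (𝓞 F) F) × (ι → AdeleRing (𝓞 F) F)) ≃ₗ[AdeleRing (𝓞 F) F]
          ((ι → AdeleRing (𝓞 F) F) × (ι → AdeleRing (𝓞 F) F))).toLinearMap ∘ₗ (LinearMap.inr _ _ _)) := by
  refine ⟨_, fun Y => ?_, rfl⟩
  rw [LinearMap.toMatrix'_mulVec]
  refine Prod.ext (hq Y) ?_
  rfl

end Block

end Literature.NumberTheory.Weil1964

end
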